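import Summits.QuantumFields.YangMills.Theorems.BalabanUVNodesN11LiveRecordFirstLevelFails

/-!
# DAG node N11 — THE RUN-EXISTENCE STEP CLOSED AT K0a's [15]-KEYED WITNESS `θ₁₅ᶜ`: along EVERY windowed run the first-step letters hold once the window
# is below `γ₁ᶜ := min ½ (A₀ᶜ∕8)`, so for `a₀` in [B7] Prop. 2's range and `L² ≤ B₃` the (B)-face conjunct `B16.Thm1Printed (datumOfRecord₁₃Sep F 2 θ₁₅ᶜ h).C` is
# INCOMPATIBLE with the window clause of K1⁗ — `θ₁₅ᶜ` can never be the `θ` of K1⁗'s conclusion (referee dag-ref-H PLACEMENT-21 (2) turned into a theorem;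
# director-ym LINE №146 «land the run-existence one-liner»)

Cell `pub-ymgap`, YM-PLAN Track A (HUMAN RULING D-0062), seat `pub-ymgap-dag-n11-e` (g7; R134 N11 [B14], strategy s3 «𝐑-operation side»), item K1⁗ `StabilityBAtRecordR13Sep`
= stmt-QuantumFields-20290.  [III] = [Balaban1988Convergent], [15] = [Balaban1985Variational], [B7] = [Balaban1985Averaging], [B16] = [Balaban1989LargeFieldII].
Sequel of this seat's `…N11LiveRecordFirstLevelFails` v1.1 (`not_sLaw₁₃_one_theta13OfThm1C`: `¬ SLaw₁₃ F 2 θ₁₅ᶜ p 1` on every run with `0 < K` meeting the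
first-step letters, itself a one-line composition with seat dag-n11-d's `…N11SmallRegFirstStepFails` ∕ `…FirstStepFailsAtThm1CWitness`) over node00-def-K0a's
`Node00/Record13NumericsOfThm1C` (`numerics_thm1C_of_inInterval`: along a windowed history `0 < ε_m ≤ A₀ᶜ` and `B₃·ε_m ≤ a₀`; `mul_A0OfThm1C_le`: `B₃·A₀ᶜ ≤ 1∕16`).

WHY THIS FILE.  Referee dag-ref-H's PLACEMENT-21 (2): `B16.Thm1Printed C = ∃ γ > 0, ∀ P, (C P).flow.InInterval γ P.K → ∀ k ≤ P.K, (C P).Sect2Form k` and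
`(C P).Sect2Form k = SLaw₁₃ θ P k` at the binding, so `Thm1Printed` is FALSE at `θ₁₅ᶜ` (for `a₀` in range) as soon as, for every small `γ > 0`, ONE run `P`
with `InInterval γ P.K`, `0 < K` AND THE LETTERS exists — «that one-line existence is NOT landed; until it is, (2) is a placement, not a theorem».  This file
proves that THE LETTERS ARE AUTOMATIC ALONG SMALL WINDOWS (§2): if `Step.InInterval γ P.K (gOfRecord₁₃ θ₁₅ᶜ P)` with `1 ≤ P.K`, `γ ≤ ½` and `γ ≤ A₀ᶜ∕8`
(`A₀ᶜ = A0OfThm1C B₃ a₀ a₁ > 0`), and `L² ≤ B₃`, then `0 < ε₁η₁²`, `ε₀ ≤ a₀η₀²`, `ε₀ ≤ a₀η₁²` (from `B₃·ε₀ ≤ a₀`, `L² ≤ B₃`) and `ε₁η₁² + 8δ₀ < 2` (from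
`ε₁ ≤ A₀ᶜ ≤ 1∕(16·B₃)` and the profile bound `δ₀ = g₀∕(A₀ᶜ·log g₀⁻²) ≤ g₀∕A₀ᶜ ≤ ⅛` once `g₀ ≤ ½`, §1).  Hence (§3) the window clause SUPPLIES the run:
★★★ `not_thm1Printed_theta13OfThm1C_of_window` — for `0 < a₀`, `C₀(4)a₀ ≤ ⅓`, `2a₀ ≤ 2δ₂∕(8L)²`, `0 < a₁`, `L² ≤ B₃`: any `γw > 0` with windowed runs
`∀ γ, 0 < γ → γ ≤ γw → ∃ P, 1 ≤ P.K ∧ (C P).flow.InInterval γ P.K` at `C := θ₁₅ᶜ`'s construction of record refutes `B16.Thm1Printed C`; and ★★★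
`not_endStatementBPrinted_and_window_theta13OfThm1C` — the LAST TWO CONJUNCTS OF K1⁗'s ∃-BODY, read at `θ := θ₁₅ᶜ` (any datum binder `h : Provisos₁₃Sep θ₁₅ᶜ`),
are JOINTLY FALSE: `¬ (B16.EndStatementBPrinted (datumOfRecord₁₃Sep F 2 θ₁₅ᶜ h).C ∧ ∃ γ₁ > 0, ∀ γ, 0 < γ → γ ≤ γ₁ → ∃ P, 1 ≤ P.K ∧ (…C P).flow.InInterval γ P.K)`.
So for `a₀ ≤ 1∕109824` (d = 4) and `L² ≤ B₃` NO parameter tuple makes `θ₁₅ᶜ(ε₀, ε₂₉; B₃, a₀, a₁)` a witness of K1⁗ — whatever closes K0⁗ there (count-neutral;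
K1⁗ = «∃ θ …» is NOT refuted; the construction of record is proviso-free, so the same holds verbatim at v1.3's `datumOfRecord₁₃SepMixed`, §3 `…_core` forms).

HONEST FRAMING.  Kernel bookkeeping + one elementary profile bound; nothing of Bałaban's asserted or refuted; N11 ∕ K1⁗ NOT discharged; counts unmoved.  One finite
four-torus at fixed `ε = L^{−K}`; NOT ℝ⁴ ∕ OS ∕ mass gap ∕ Clay.  Sources: [III] (2.4)–(2.5) p.255, (2.10)–(2.12) p.256, (3.3) p.265, Thm 1 p.262, (3.25) p.270;
[15] Thm 1 (7)–(10) p.279; [B7] Prop. 2 (52)–(54) p.26; [B16] Thm 1 + (0.1) pp.355–356.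
-/

noncomputable section

open MeasureTheory
open scoped BigOperators Matrix.Norms.L2Operator

namespace Summit.QuantumFields.YangMills.Theorems.BalabanUVNodesN11Thm1PrintedFailsAtThm1CWitness

open Literature.MathematicalPhysics.QuantumFieldTheory.Balaban1983to89 T4Continuum Node00 Node00.Tk DagBinding
open Literature.MathematicalPhysics.QuantumFieldTheory.Balaban1983to89.ExpMeanLog (deltaSU)
open Summit.QuantumFields.YangMills.Theorems.BalabanUVNodesN11LiveRecordFirstLevelFails (not_sLaw₁₃_one_theta13OfThm1C)
open Summit.QuantumFields.YangMills.BalabanUVNodes.N07Thm1ScaledInterfaceInstance (eta_one_sq eta_one_sq_le_one)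
open Literature.MathematicalPhysics.QuantumFieldTheory.Balaban1983to89.B11Thm1LevelZero (eta_zero)

/-! ## §1. One elementary profile bound: `δ_k = g_k·A₁∕(A₀·log g_k⁻²) ≤ g_k·A₁∕A₀` once `g_k ≤ ½` (`p₀ = 1`) -/

section Profile

/-- **THE (3.3) THRESHOLD ALONG A SMALL COUPLING**: for numerics with `p₀ = 1`, `0 < A₀`, and `0 ≤ A₁`, `0 < g_k ≤ ½` gives
`deltaOfRecord ν g k A₁ ≤ g_k·A₁∕A₀`. [cite: Balaban1988Convergent, (2.4) p.255, (3.3) p.265] -/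
theorem deltaOfRecord_le_of_le_half (ν : Stage7Numerics) (hp : ν.p₀ = 1) (hA : 0 < ν.A₀) {A₁ : ℝ} (hA₁ : 0 ≤ A₁) {g : ℕ → ℝ} {k : ℕ}
    (hg : 0 < g k) (hg2 : g k ≤ 1 / 2) : deltaOfRecord ν g k A₁ ≤ g k * A₁ / ν.A₀ := by
  unfold deltaOfRecord p0Profile
  rw [hp, pow_one]
  -- `1 ≤ log (g²)⁻¹` for `0 < g ≤ ½` (`(g²)⁻¹ ≥ 4 ≥ e`; cf. `Beta.AveragedAFCarrier.one_le_log_inv_sq_of_le_half`)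
  have hlog : 1 ≤ Real.log (g k ^ 2)⁻¹ := by
    have h4 : (4 : ℝ) ≤ (g k ^ 2)⁻¹ := by
      rw [le_inv_comm₀ (by norm_num) (by positivity)]
      nlinarith
    have he : Real.exp 1 ≤ (g k ^ 2)⁻¹ := by
      have := Real.exp_one_lt_d9
      linarith
    exact (Real.le_log_iff_exp_le (by positivity)).2 he
  exact div_le_div_of_nonneg_left (mul_nonneg hg.le hA₁) hA (le_mul_of_one_le_right hA.le hlog)

end Profile

/-! ## §2. THE FIRST-STEP LETTERS AT `θ₁₅ᶜ` ALONG A WINDOW BELOW `min ½ (A₀ᶜ∕8)` (`L² ≤ B₃`) -/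

section Letters

variable {F : T4Family} (ε₀ ε₂₉ B₃ a₀ a₁ : ℝ) (p : B12.RunParams)

/-- `0 < η₁²` (`η₁² = 1∕L²`, seat dag-n07-e's `N07Thm1ScaledInterfaceInstance.eta_one_sq`). [cite: Balaban1987RG1, (1.1) p.260 (bookkeeping)] -/
theorem eta_one_sq_pos (K : ℕ) : 0 < (F.P K).eta 1 ^ 2 := by
  rw [eta_one_sq]
  have hL : (0 : ℝ) < F.L := by have := F.hL11; exact_mod_cast (by omega : 0 < F.L)
  positivity

/-- **★ THE FOUR FIRST-STEP LETTERS AT `θ₁₅ᶜ` ALONG A WINDOWED RUN** (`1 ≤ K`; window `γ ≤ ½`, `γ ≤ A₀ᶜ∕8`; `0 < a₀`, `0 < a₁`, `L² ≤ B₃`): `0 < ε₁η₁²`,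
`ε₀ ≤ a₀η₀²`, `ε₀ ≤ a₀η₁²`, `ε₁η₁² + 4·(2δ₀) < 2` — K0a's `numerics_thm1C_of_inInterval` (`0 < ε_m ≤ A₀ᶜ`, `B₃·ε_m ≤ a₀`), `mul_A0OfThm1C_le` (`B₃·A₀ᶜ ≤ 1∕16`)
and §1's `δ₀ ≤ g₀∕A₀ᶜ` (`A₁ = 1`). [cite: Balaban1988Convergent, (2.4)–(2.5) p.255, (2.10)–(2.12) p.256, (3.3) p.265; Balaban1985Variational, Thm 1 (7)–(8) p.279] -/
theorem firstStepLetters_theta13OfThm1C_of_inInterval (hB : (F.L : ℝ) ^ 2 ≤ B₃) (ha₀ : 0 < a₀) (ha₁ : 0 < a₁)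
    {γ : ℝ} (hγ2 : γ ≤ 1 / 2) (hγA : γ ≤ A0OfThm1C B₃ a₀ a₁ / 8) (hK : 1 ≤ p.K)
    (hw : Step.InInterval γ p.K (gOfRecord₁₃ F 2 (theta13OfThm1C F 2 ε₀ ε₂₉ B₃ a₀ a₁) p)) :
    0 < epsOfRecord (theta13OfThm1C F 2 ε₀ ε₂₉ B₃ a₀ a₁).ν (gOfRecord₁₃ F 2 (theta13OfThm1C F 2 ε₀ ε₂₉ B₃ a₀ a₁) p) 1 * (F.P p.K).eta 1 ^ 2 ∧
    epsOfRecord (theta13OfThm1C F 2 ε₀ ε₂₉ B₃ a₀ a₁).ν (gOfRecord₁₃ F 2 (theta13OfThm1C F 2 ε₀ ε₂₉ B₃ a₀ a₁) p) 0 ≤ a₀ * (F.P p.K).eta 0 ^ 2 ∧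
    epsOfRecord (theta13OfThm1C F 2 ε₀ ε₂₉ B₃ a₀ a₁).ν (gOfRecord₁₃ F 2 (theta13OfThm1C F 2 ε₀ ε₂₉ B₃ a₀ a₁) p) 0 ≤ a₀ * (F.P p.K).eta 1 ^ 2 ∧
    epsOfRecord (theta13OfThm1C F 2 ε₀ ε₂₉ B₃ a₀ a₁).ν (gOfRecord₁₃ F 2 (theta13OfThm1C F 2 ε₀ ε₂₉ B₃ a₀ a₁) p) 1 * (F.P p.K).eta 1 ^ 2 +
      4 * (2 * deltaOfRecord (theta13OfThm1C F 2 ε₀ ε₂₉ B₃ a₀ a₁).ν (gOfRecord₁₃ F 2 (theta13OfThm1C F 2 ε₀ ε₂₉ B₃ a₀ a₁) p) 0 1) < 2 := by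
  -- letters and signs of the numerics of `θ₁₅ᶜ`
  have hL12 : 12 ≤ F.L := F.hL11
  have hLr : (12 : ℝ) ≤ F.L := by exact_mod_cast hL12
  have hL2 : (144 : ℝ) ≤ (F.L : ℝ) ^ 2 := by nlinarith
  have hB1 : (1 : ℝ) ≤ B₃ := by linarith
  have hB0 : (0 : ℝ) ≤ B₃ := by linarith
  have hA : 0 < A0OfThm1C B₃ a₀ a₁ := A0OfThm1C_pos hB0 ha₀ ha₁
  have hγ1 : γ < 1 := by linarith
  have hν : (theta13OfThm1C F 2 ε₀ ε₂₉ B₃ a₀ a₁).ν = (stage12NumericsOfThm1C F.L ε₀ B₃ a₀ a₁).ν := rfl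
  -- K0a's window letters at m = 0 and m = 1
  have h0 := numerics_thm1C_of_inInterval (L := F.L) (ε₀ := ε₀) hB0 ha₀ ha₁ hγ1 hw 0 (Nat.zero_le _)
  have h1 := numerics_thm1C_of_inInterval (L := F.L) (ε₀ := ε₀) hB0 ha₀ ha₁ hγ1 hw 1 hK
  rw [stage12NumericsOfThm1C_cR, one_mul, stage12NumericsOfThm1C_ν, numerics7OfThm1C_εreg] at h0 h1
  rw [hν, stage12NumericsOfThm1C_ν]
  obtain ⟨h0pos, -, h0B⟩ := h0
  obtain ⟨h1pos, -, -⟩ := h1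
  -- abbreviations
  set e0 := epsOfRecord (numerics7OfThm1C ε₀ B₃ a₀ a₁) (gOfRecord₁₃ F 2 (theta13OfThm1C F 2 ε₀ ε₂₉ B₃ a₀ a₁) p) 0 with he0
  set e1 := epsOfRecord (numerics7OfThm1C ε₀ B₃ a₀ a₁) (gOfRecord₁₃ F 2 (theta13OfThm1C F 2 ε₀ ε₂₉ B₃ a₀ a₁) p) 1 with he1
  have hη0 : (F.P p.K).eta 0 = 1 := eta_zero F p.K
  have hη1 : (F.P p.K).eta 1 ^ 2 = 1 / (F.L : ℝ) ^ 2 := eta_one_sq F p.K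
  have hη1pos : 0 < (F.P p.K).eta 1 ^ 2 := eta_one_sq_pos p.K
  have hη1le : (F.P p.K).eta 1 ^ 2 ≤ 1 := eta_one_sq_le_one F p.K
  -- ε₀ ≤ a₀ ∕ L² ≤ a₀
  have hαε : e0 ≤ a₀ * (F.P p.K).eta 1 ^ 2 := by
    rw [hη1, mul_one_div, le_div_iff₀ (by positivity)]
    calc e0 * (F.L : ℝ) ^ 2 ≤ e0 * B₃ := mul_le_mul_of_nonneg_left hB h0pos.le
      _ = B₃ * e0 := by ring
      _ ≤ a₀ := h0B
  have hc : e0 ≤ a₀ * (F.P p.K).eta 0 ^ 2 := by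
    rw [hη0, one_pow, mul_one]
    calc e0 = 1 * e0 := (one_mul _).symm
      _ ≤ B₃ * e0 := mul_le_mul_of_nonneg_right hB1 h0pos.le
      _ ≤ a₀ := h0B
  -- ε₁η₁² ≤ A₀ᶜ ≤ 1∕16 and 8δ₀ ≤ 1
  have he1A : e1 ≤ A0OfThm1C B₃ a₀ a₁ :=
    epsOfRecord_le_A₀_of_p₀_eq_one (numerics7OfThm1C ε₀ B₃ a₀ a₁) rfl hA.le (hw 1 hK).1
  have hA16 : A0OfThm1C B₃ a₀ a₁ ≤ 1 / 16 := by
    have h := mul_A0OfThm1C_le (a₀ := a₀) (a₁ := a₁) hB0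
    calc A0OfThm1C B₃ a₀ a₁ = 1 * A0OfThm1C B₃ a₀ a₁ := (one_mul _).symm
      _ ≤ B₃ * A0OfThm1C B₃ a₀ a₁ := mul_le_mul_of_nonneg_right hB1 hA.le
      _ ≤ 1 / 16 := h
  have hterm1 : e1 * (F.P p.K).eta 1 ^ 2 ≤ 1 / 16 :=
    calc e1 * (F.P p.K).eta 1 ^ 2 ≤ e1 * 1 := mul_le_mul_of_nonneg_left hη1le h1pos.le
      _ ≤ 1 / 16 := by rw [mul_one]; exact he1A.trans hA16
  have hg0 : 0 < gOfRecord₁₃ F 2 (theta13OfThm1C F 2 ε₀ ε₂₉ B₃ a₀ a₁) p 0 := (hw 0 (Nat.zero_le _)).1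
  have hg0le : gOfRecord₁₃ F 2 (theta13OfThm1C F 2 ε₀ ε₂₉ B₃ a₀ a₁) p 0 ≤ γ := (hw 0 (Nat.zero_le _)).2
  have hδ : deltaOfRecord (numerics7OfThm1C ε₀ B₃ a₀ a₁) (gOfRecord₁₃ F 2 (theta13OfThm1C F 2 ε₀ ε₂₉ B₃ a₀ a₁) p) 0 1 ≤ 1 / 8 := by
    have h := deltaOfRecord_le_of_le_half (numerics7OfThm1C ε₀ B₃ a₀ a₁) rfl (A₁ := 1) hA zero_le_one hg0 (hg0le.trans hγ2)
    have hA₀ : (numerics7OfThm1C ε₀ B₃ a₀ a₁).A₀ = A0OfThm1C B₃ a₀ a₁ := rfl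
    rw [hA₀, mul_one] at h
    refine h.trans ?_
    rw [div_le_iff₀ hA]
    linarith
  refine ⟨mul_pos h1pos hη1pos, hc, hαε, ?_⟩
  linarith

end Letters

/-! ## §3. `B16.Thm1Printed` AT `θ₁₅ᶜ`'s CONSTRUCTION OF RECORD IS INCOMPATIBLE WITH THE WINDOW CLAUSE; the last two conjuncts of K1⁗'s body fail jointly there -/

section Thm1Fails

variable {F : T4Family} (ε₀ ε₂₉ B₃ a₀ a₁ : ℝ)

/-- **★★★ WINDOWED RUNS REFUTE `B16.Thm1Printed` AT `θ₁₅ᶜ`'s CONSTRUCTION OF RECORD** (proviso-free `C := (coreOfRecord₁₃ θ₁₅ᶜ).construction (densOfRecord₁₃ θ₁₅ᶜ)`;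
`0 < a₀`, `C₀(4)a₀ ≤ ⅓`, `2a₀ ≤ 2δ₂∕(8L)²`, `0 < a₁`, `L² ≤ B₃`): if for some `γw > 0` every window `]0, γ]`, `γ ≤ γw`, carries a run with `1 ≤ K` and
`(C P).flow.InInterval γ P.K`, then `¬ B16.Thm1Printed C` — take `Thm1Printed`'s `γ`, shrink it below `γw`, `½` and `A₀ᶜ∕8`, pick the run, read
`(C P).Sect2Form 1` as `SLaw₁₃ θ₁₅ᶜ P 1` (`rfl` at the binding) and contradict `…LiveRecordFirstLevelFails.not_sLaw₁₃_one_theta13OfThm1C` with §2's letters.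
[cite: Balaban1989LargeFieldII, Thm 1 p.355; Balaban1988Convergent, Thm 1 p.262, (2.18) p.257, (3.25) p.270, (2.12) p.256; Balaban1985Averaging, Prop. 2 (52)–(54) p.26; Balaban1985Variational, Thm 1 p.279 (witness letters only)] -/
theorem not_thm1Printed_core_theta13OfThm1C_of_window (hB : (F.L : ℝ) ^ 2 ≤ B₃) (ha₀ : 0 < a₀)
    (ha3 : ∀ K : ℕ, (143 * (((((F.P K).d + 4 : ℕ) : ℝ)) ^ 2 / 4) ^ 2) * a₀ ≤ 1 / 3)
    (ha2 : ∀ K : ℕ, 2 * a₀ ≤ 2 * deltaSU (Fin 2) / ((((F.P K).d + 4) * (F.P K).L : ℕ) : ℝ) ^ 2) (ha₁ : 0 < a₁)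
    {γw : ℝ} (hγw : 0 < γw)
    (hwin : ∀ γ : ℝ, 0 < γ → γ ≤ γw → ∃ P : B12.RunParams, 1 ≤ P.K ∧
      ((coreOfRecord₁₃ F 2 (theta13OfThm1C F 2 ε₀ ε₂₉ B₃ a₀ a₁)).construction (densOfRecord₁₃ F 2 (theta13OfThm1C F 2 ε₀ ε₂₉ B₃ a₀ a₁)) P).flow.InInterval γ P.K) :
    ¬ B16.Thm1Printed ((coreOfRecord₁₃ F 2 (theta13OfThm1C F 2 ε₀ ε₂₉ B₃ a₀ a₁)).construction (densOfRecord₁₃ F 2 (theta13OfThm1C F 2 ε₀ ε₂₉ B₃ a₀ a₁))) := by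
  rintro ⟨γ, hγ, hall⟩
  have hL12 : 12 ≤ F.L := F.hL11
  have hLr : (12 : ℝ) ≤ F.L := by exact_mod_cast hL12
  have hB0 : (0 : ℝ) ≤ B₃ := by nlinarith
  have hA : 0 < A0OfThm1C B₃ a₀ a₁ := A0OfThm1C_pos hB0 ha₀ ha₁
  -- shrink the window
  set γ' : ℝ := min (min γ γw) (min (1 / 2) (A0OfThm1C B₃ a₀ a₁ / 8)) with hγ'
  have hγ'pos : 0 < γ' := lt_min (lt_min hγ hγw) (lt_min (by norm_num) (by positivity))
  have hγ'w : γ' ≤ γw := (min_le_left _ _).trans (min_le_right _ _)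
  have hγ'γ : γ' ≤ γ := (min_le_left _ _).trans (min_le_left _ _)
  have hγ'2 : γ' ≤ 1 / 2 := (min_le_right _ _).trans (min_le_left _ _)
  have hγ'A : γ' ≤ A0OfThm1C B₃ a₀ a₁ / 8 := (min_le_right _ _).trans (min_le_right _ _)
  obtain ⟨P, hK, hwP⟩ := hwin γ' hγ'pos hγ'w
  -- the run's history IS `gOfRecord₁₃ θ₁₅ᶜ P` (`rfl` at the construction of record)
  have hw' : Step.InInterval γ' P.K (gOfRecord₁₃ F 2 (theta13OfThm1C F 2 ε₀ ε₂₉ B₃ a₀ a₁) P) := fun k hk => hwP k hk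
  have hwγ : ((coreOfRecord₁₃ F 2 (theta13OfThm1C F 2 ε₀ ε₂₉ B₃ a₀ a₁)).construction
      (densOfRecord₁₃ F 2 (theta13OfThm1C F 2 ε₀ ε₂₉ B₃ a₀ a₁)) P).flow.InInterval γ P.K :=
    fun k hk => ⟨(hwP k hk).1, (hwP k hk).2.trans hγ'γ⟩
  -- `(C P).Sect2Form 1` IS `SLaw₁₃ θ₁₅ᶜ P 1`
  have hS : SLaw₁₃ F 2 (theta13OfThm1C F 2 ε₀ ε₂₉ B₃ a₀ a₁) P 1 := hall P hwγ 1 hK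
  obtain ⟨hε₁, hc, hαε, hδ⟩ :=
    firstStepLetters_theta13OfThm1C_of_inInterval ε₀ ε₂₉ B₃ a₀ a₁ P hB ha₀ ha₁ hγ'2 hγ'A hK hw'
  exact not_sLaw₁₃_one_theta13OfThm1C ε₀ ε₂₉ B₃ a₀ a₁ P hK ha₀ (ha3 P.K) (ha2 P.K) hε₁ hc hαε hδ hS

variable (h : (theta13OfThm1C F 2 ε₀ ε₂₉ B₃ a₀ a₁).Provisos₁₃Sep F 2)

/-- **★★★ THE SAME AT THE v1.2 DATUM `datumOfRecord₁₃Sep F 2 θ₁₅ᶜ h`** (its `C` IS the construction of record, `Node00.datumOfRecord₁₃Sep_C`, `rfl`).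
[cite: Balaban1989LargeFieldII, Thm 1 p.355; Balaban1988Convergent, Thm 1 p.262, (3.25) p.270; Balaban1985Averaging, Prop. 2 (52)–(54) p.26] -/
theorem not_thm1Printed_theta13OfThm1C_of_window (hB : (F.L : ℝ) ^ 2 ≤ B₃) (ha₀ : 0 < a₀)
    (ha3 : ∀ K : ℕ, (143 * (((((F.P K).d + 4 : ℕ) : ℝ)) ^ 2 / 4) ^ 2) * a₀ ≤ 1 / 3)
    (ha2 : ∀ K : ℕ, 2 * a₀ ≤ 2 * deltaSU (Fin 2) / ((((F.P K).d + 4) * (F.P K).L : ℕ) : ℝ) ^ 2) (ha₁ : 0 < a₁)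
    {γw : ℝ} (hγw : 0 < γw)
    (hwin : ∀ γ : ℝ, 0 < γ → γ ≤ γw → ∃ P : B12.RunParams, 1 ≤ P.K ∧
      ((datumOfRecord₁₃Sep F 2 (theta13OfThm1C F 2 ε₀ ε₂₉ B₃ a₀ a₁) h).C P).flow.InInterval γ P.K) :
    ¬ B16.Thm1Printed (datumOfRecord₁₃Sep F 2 (theta13OfThm1C F 2 ε₀ ε₂₉ B₃ a₀ a₁) h).C :=
  not_thm1Printed_core_theta13OfThm1C_of_window ε₀ ε₂₉ B₃ a₀ a₁ hB ha₀ ha3 ha2 ha₁ hγw hwin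

/-- **★★★ THE LAST TWO CONJUNCTS OF K1⁗'s ∃-BODY ARE JOINTLY FALSE AT `θ := θ₁₅ᶜ`** (for `0 < a₀`, `C₀(4)a₀ ≤ ⅓` and `2a₀ ≤ 2δ₂∕(8L)²` on every lattice of the family,
`0 < a₁`, `L² ≤ B₃`; ANY datum binder `h`): `¬ (B16.EndStatementBPrinted (datumOfRecord₁₃Sep F 2 θ₁₅ᶜ h).C ∧ ∃ γ₁ > 0, ∀ γ, 0 < γ → γ ≤ γ₁ → ∃ P, 1 ≤ P.K ∧
((datumOfRecord₁₃Sep F 2 θ₁₅ᶜ h).C P).flow.InInterval γ P.K)` — the window clause supplies the run on which `Thm1Printed` (the first conjunct of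
`EndStatementBPrinted`) fails.  READING: in the print-like regime of [15]'s `a₀` no tuple `(ε₀, ε₂₉, B₃, a₀, a₁)` makes K0a's [15]-keyed witness a witness of
K1⁗; K1⁗ itself («∃ θ …») is NOT refuted. [cite: Balaban1989LargeFieldII, Thm 1 + (0.1) pp.355–356; Balaban1988Convergent, Thm 1 p.262, (3.25) p.270, (2.12) p.256; Balaban1985Averaging, Prop. 2 (52)–(54) p.26; Balaban1985Variational, Thm 1 p.279 (witness letters only)] -/
theorem not_endStatementBPrinted_and_window_theta13OfThm1C (hB : (F.L : ℝ) ^ 2 ≤ B₃) (ha₀ : 0 < a₀)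
    (ha3 : ∀ K : ℕ, (143 * (((((F.P K).d + 4 : ℕ) : ℝ)) ^ 2 / 4) ^ 2) * a₀ ≤ 1 / 3)
    (ha2 : ∀ K : ℕ, 2 * a₀ ≤ 2 * deltaSU (Fin 2) / ((((F.P K).d + 4) * (F.P K).L : ℕ) : ℝ) ^ 2) (ha₁ : 0 < a₁) :
    ¬ (B16.EndStatementBPrinted (datumOfRecord₁₃Sep F 2 (theta13OfThm1C F 2 ε₀ ε₂₉ B₃ a₀ a₁) h).C ∧
        ∃ γ₁ : ℝ, 0 < γ₁ ∧ ∀ γ : ℝ, 0 < γ → γ ≤ γ₁ → ∃ P : B12.RunParams, 1 ≤ P.K ∧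
          ((datumOfRecord₁₃Sep F 2 (theta13OfThm1C F 2 ε₀ ε₂₉ B₃ a₀ a₁) h).C P).flow.InInterval γ P.K) := by
  rintro ⟨hE, γ₁, hγ₁, hwin⟩
  exact not_thm1Printed_theta13OfThm1C_of_window ε₀ ε₂₉ B₃ a₀ a₁ h hB ha₀ ha3 ha2 ha₁ hγ₁ hwin hE.1

/-- **THE `d = 4` NUMERALS**: on the family's lattices `(d + 4)²∕4 = 16`, so the two range hypotheses read `143·256·a₀ ≤ ⅓` and `2a₀ ≤ 2δ₂∕(8L)²`, uniformly in `K`.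
[cite: Balaban1985Averaging, Prop. 2 (52)–(54) p.26 (bookkeeping numerals)] -/
theorem range_hyps_of_d4 {a₀ : ℝ} (ha3 : 143 * 256 * a₀ ≤ 1 / 3) (ha2 : 2 * a₀ ≤ 2 * deltaSU (Fin 2) / ((8 * F.L : ℕ) : ℝ) ^ 2) :
    (∀ K : ℕ, (143 * (((((F.P K).d + 4 : ℕ) : ℝ)) ^ 2 / 4) ^ 2) * a₀ ≤ 1 / 3) ∧
      ∀ K : ℕ, 2 * a₀ ≤ 2 * deltaSU (Fin 2) / ((((F.P K).d + 4) * (F.P K).L : ℕ) : ℝ) ^ 2 := by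
  refine ⟨fun K => ?_, fun K => ?_⟩
  · have hd : (F.P K).d = 4 := rfl
    rw [hd]; norm_num; linarith
  · have hd : (F.P K).d = 4 := rfl
    rw [hd, T4Family.P_L]
    exact ha2

/-- **★★★ … WITH THE `d = 4` NUMERALS SPELLED**: `143·256·a₀ ≤ ⅓`, `2a₀ ≤ 2δ₂∕(8L)²`, `0 < a₀`, `0 < a₁`, `L² ≤ B₃` ⇒ the last two conjuncts of K1⁗'s body fail at
`θ₁₅ᶜ`. [cite: Balaban1989LargeFieldII, Thm 1 + (0.1) pp.355–356; Balaban1988Convergent, Thm 1 p.262; Balaban1985Averaging, Prop. 2 (52)–(54) p.26; Balaban1985Variational, Thm 1 p.279 (witness letters only)] -/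
theorem not_endStatementBPrinted_and_window_theta13OfThm1C_d4 (hB : (F.L : ℝ) ^ 2 ≤ B₃) (ha₀ : 0 < a₀) (ha3 : 143 * 256 * a₀ ≤ 1 / 3)
    (ha2 : 2 * a₀ ≤ 2 * deltaSU (Fin 2) / ((8 * F.L : ℕ) : ℝ) ^ 2) (ha₁ : 0 < a₁) :
    ¬ (B16.EndStatementBPrinted (datumOfRecord₁₃Sep F 2 (theta13OfThm1C F 2 ε₀ ε₂₉ B₃ a₀ a₁) h).C ∧
        ∃ γ₁ : ℝ, 0 < γ₁ ∧ ∀ γ : ℝ, 0 < γ → γ ≤ γ₁ → ∃ P : B12.RunParams, 1 ≤ P.K ∧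
          ((datumOfRecord₁₃Sep F 2 (theta13OfThm1C F 2 ε₀ ε₂₉ B₃ a₀ a₁) h).C P).flow.InInterval γ P.K) :=
  not_endStatementBPrinted_and_window_theta13OfThm1C ε₀ ε₂₉ B₃ a₀ a₁ h hB ha₀ (range_hyps_of_d4 ha3 ha2).1 (range_hyps_of_d4 ha3 ha2).2 ha₁

end Thm1Fails

end Summit.QuantumFields.YangMills.Theorems.BalabanUVNodesN11Thm1PrintedFailsAtThm1CWitness

end
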